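import HarnessLib

/-!
# BirchSwinnertonDyer — rank ≥ 2 observatory: gen-6 joins of the anom census (p = 3 exact leading-term instrument,
Kurihara-lane refresh, gen-6 Ш-parts ledger) — DATA

HONEST FRAMING: per-curve certified theorems and census instruments; no claim on BSD in rank ≥ 2.

CENSUS DATA ONLY (REFEREE P6/R7: DATA-labelled `def`s, never theorems about elliptic curves). Companion of
`Rank2ObservatoryAnomJoins3` / `Rank2ObservatoryAnomLedger` (same sources and conventions): every `def` transcribes a number
printed in `run/shared/lean/b2b/bsd-rank2-observatory/b2b-bsdr2-anom/CONSISTENCY-JOINS.md` §J8, §J4-g6/J5-g6/J6-g6, §J7-g6 and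
§J3.9 (final), and its machine-readable source under `b2b-bsdr2-anom/joins-outputs/` (`JOIN-U3.summary.json`,
`JOIN-KURIHARA-g6.summary.json`, `JOIN-KURIHARA-LOCAL-g6.summary.json`, `j5impl2-j103457/J5-IMPL2-AGREEMENT.json`,
`JOIN-KURIHARA-PADIC-g6.summary.json`, `SHA-PARTS-LEDGER-g6.summary.json`, `desc3-budget37-combined/desc3.jsonl`; sha256 of every
input recorded in each summary; re-verified by `b2b-bsdr2-anom/MANIFEST-CHECK.md`). The census verdicts are unchanged: 358 159 rows
consistent, anomalies under verification 0. The p-adic columns (J2, J8) are INSTRUMENT READINGS, never theorems about Ш; the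
`GRH_BNF` token is conditional and never counted as unconditional. The `example`s are bookkeeping identities by `decide`.
-/

namespace Summit.BirchSwinnertonDyer.BirchSwinnertonDyer.Rank2Observatory.AnomJoins4

/-! ## J8 — census × padic-3 U3 at p = 3 (exact 3-adic leading coefficient; unit-part quotient `S_A` against the census `S`)

`code/b2b-bsdr2-anom/joins/join_u3.py` joins, for curve 1 of every census class with `N < 10⁵`, `3 ∤ N`, good reduction at 3
(padic-3 tiers R2A–R2D rank 2, R3A rank 3; PREREG-U3 / OUTCOMES-U3), padic-3's EXACT leading coefficient `c_r = [T^r] L₃(E,T)` and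
unit-part quotient `S_A = (1 − 1/α)⁻² · log₃(4)^r · c_r · #T² / (Tam · R₃) (mod 3^a)` on the good ORDINARY cells, and the Mazur–Tate
weak-vanishing orders on the supersingular rows, to the census. Checks recomputed from the published lifts: C1 label / rank; C2
padic-3's INPUTS (`sha_an`, `#T`, Tamagawa product, `a₃` — own point count over `F₃` —, good ordinary) equal the census's exact
two-engine values; C3 `S_A ≡ S (mod 3^a)`, `a ≥ 1`, `v₃(S_A) = v₃(S) = 0`; C4 `ord_T = r`; deep cells (`c_r ≡ 0` to the tier
precision) are decided by padic-3's top-level-3⁹ re-runs (U3-DEEP, U3-DEEP2) where available, else `undetermined` (NOT an anomaly). Output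
`joins-outputs/JOIN-U3.tsv.gz` (20 184 rows; uncompressed sha256 `d08e63ef9026b5f9…`). -/

/-- DATA (not a theorem): one padic-3 U3 tier as joined: rows in the tier file, good-ordinary `ok` cells of census curves, cells
passing C1–C4 (`consistent`), deep cells still undetermined, deep cells decided by a U3-DEEP / U3-DEEP2 override, supersingular rows whose
Mazur–Tate weak-vanishing orders are `≥` the census rank at every layer, anomalies under verification. -/
structure U3Tier where
  tier : String
  rank : Nat
  rows : Nat
  ordinaryCells : Nat
  consistent : Nat
  undetermined : Nat
  deepOverrides : Nat
  ssMtConsistent : Nat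
  anomaliesUnderVerification : Nat
  deriving Repr, DecidableEq

/-- DATA (not a theorem): `JOIN-U3.summary.json: per_tier` (R2A additionally has 5 rank-0/1 calibration curves not in the census). -/
def u3Tiers : List U3Tier := [
  { tier := "R2A", rank := 2, rows := 1141, ordinaryCells := 730, consistent := 730, undetermined := 0, deepOverrides := 0, ssMtConsistent := 406,
    anomaliesUnderVerification := 0 },
  { tier := "R2B", rank := 2, rows := 3629, ordinaryCells := 2428, consistent := 2428, undetermined := 0, deepOverrides := 6, ssMtConsistent := 1201,
    anomaliesUnderVerification := 0 },
  { tier := "R2C", rank := 2, rows := 6318, ordinaryCells := 4208, consistent := 4207, undetermined := 1, deepOverrides := 20,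
    ssMtConsistent := 2110, anomaliesUnderVerification := 0 },
  { tier := "R2D", rank := 2, rows := 8714, ordinaryCells := 5885, consistent := 5885, undetermined := 0, deepOverrides := 36,
    ssMtConsistent := 2829, anomaliesUnderVerification := 0 },
  { tier := "R3A", rank := 3, rows := 382, ordinaryCells := 246, consistent := 246, undetermined := 0, deepOverrides := 4, ssMtConsistent := 136,
    anomaliesUnderVerification := 0 } ]

/-- DATA (not a theorem): J8 totals — ordinary cells, consistent (rank 2 + rank 3), undetermined deep cells (c_r = 0 to the
available precision even in padic-3's deep re-runs U3-DEEP / U3-DEEP2 at top level 3^9: no nonzero digit determined, nothing to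
compare; not anomalies), cells whose U3 INPUTS match the census exact values, deep overrides used / deep rows not usable (still
undetermined at 3^9) / deep rows available,
R2A cells on which padic-3's two symbol engines (A-ms, PARI `msfromell`) agree in every derived column, supersingular rows
MT-consistent, census classes in U3's range with a row / classes in range, class-mates not instrumented (curve ≥ 2 of a class;
`S_A`'s factors are not isogeny-invariant), calibration curves not in the census, labels in more than one tier, anomalies. -/
structure U3Totals where
  (ordinaryCells consistent consistentRankTwo consistentRankThree undetermined inputsMatchCensus : Nat)
  (deepOverridesUsed deepRowsUnused deepRows rTwoASymTwoEngineAgree ssMtConsistent ssMtConsistentRankTwo : Nat)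
  (ssMtConsistentRankThree classesWithRow classesInRange classMatesNotInstrumented calibrationNotInCensus labelsInTwoTiers : Nat)
  (anomaliesUnderVerification : Nat)
  outputSha256 : String
  deriving Repr, DecidableEq

/-- DATA (not a theorem): `JOIN-U3.summary.json` totals. -/
def u3Totals : U3Totals :=
  { ordinaryCells := 13497, consistent := 13496, consistentRankTwo := 13250, consistentRankThree := 246, undetermined := 1,
    inputsMatchCensus := 13497, deepOverridesUsed := 66, deepRowsUnused := 1, deepRows := 67, rTwoASymTwoEngineAgree := 730,
    ssMtConsistent := 6682, ssMtConsistentRankTwo := 6546, ssMtConsistentRankThree := 136, classesWithRow := 20179, classesInRange := 20179,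
    classMatesNotInstrumented := 3401, calibrationNotInCensus := 5, labelsInTwoTiers := 0, anomaliesUnderVerification := 0,
    outputSha256 := "d08e63ef9026b5f9" }

/-- DATA (not a theorem): histogram of the 3-adic precision `a` of the agreement `S_A ≡ S (mod 3^a)` over the consistent cells
(pairs `(a, cells)`), and the split of the consistent cells by the row's `Ш[3]`-column token: unconditional 3-descent token /
`GRH_BNF` — the three p = 3 instruments (3 ∤ S, `dim Ш(E)[3] = 0` by descent, `S_A ≡ S`) side by side. -/
def u3PrecisionHist : List (Nat × Nat) := [(5, 9017), (4, 2848), (3, 1122), (2, 380), (1, 129)]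
/-- DATA (not a theorem): consistent J8 cells whose row carries an UNCONDITIONAL `Ш[3] = 0` token (3 ∤ S, descent, `S_A ≡ S`). -/
def u3ThreeInstrumentsUnconditional : Nat := 698
/-- DATA (not a theorem): consistent J8 cells whose row carries the GRH-conditional `GRH_BNF` token for `Ш[3] = 0`. -/
def u3ThreeInstrumentsGrh : Nat := 12798

example : (u3Tiers.map (·.consistent)).sum = u3Totals.consistent
    ∧ (u3Tiers.map (·.undetermined)).sum = u3Totals.undetermined
    ∧ (u3Tiers.map (·.ordinaryCells)).sum = u3Totals.ordinaryCells
    ∧ (u3Tiers.map (·.ssMtConsistent)).sum = u3Totals.ssMtConsistent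
    ∧ (u3Tiers.map (·.deepOverrides)).sum = u3Totals.deepOverridesUsed
    ∧ (u3Tiers.map (·.anomaliesUnderVerification)).sum = 0 ∧ u3Totals.anomaliesUnderVerification = 0 := by decide
example : u3Totals.consistent + u3Totals.undetermined = u3Totals.ordinaryCells
    ∧ u3Totals.consistentRankTwo + u3Totals.consistentRankThree = u3Totals.consistent
    ∧ u3Totals.ssMtConsistentRankTwo + u3Totals.ssMtConsistentRankThree = u3Totals.ssMtConsistent
    ∧ u3Totals.inputsMatchCensus = u3Totals.ordinaryCells ∧ u3Totals.deepOverridesUsed + u3Totals.deepRowsUnused = u3Totals.deepRows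
    ∧ u3Totals.deepRowsUnused ≤ u3Totals.undetermined
    ∧ u3Totals.classesWithRow = u3Totals.classesInRange ∧ u3Totals.labelsInTwoTiers = 0
    ∧ (u3PrecisionHist.map (·.2)).sum = u3Totals.consistent
    ∧ u3ThreeInstrumentsUnconditional + u3ThreeInstrumentsGrh = u3Totals.consistent := by decide

/-! ## J4-g6 / J5-g6 / J6-g6 — Kurihara-lane refresh (lane snapshot 2026-08-20T17:32:13Z: 393 851 lines, sha256-as-streamed `e53f8b0d00352d37…`, N ≤
59 998)

Same scripts and checks as J4/J5/J6 (gen 4; Kim, Amer. J. Math. 148, Thm 1.8, every hypothesis recomputed: Kolyvagin primes by own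
point counts, `ρ̄_{E,p}` surjective by own Serre-Prop.-19 witnesses AND the galrep table, `ν(n) = r`, census rank certificate,
`v_p(S) = 0`; class extension through prime-to-p isogenies); only the lane input grew. The gen-4 tables of record are kept; the
refresh is published with the suffix `-g6` (`JOIN-KURIHARA-g6.*`, `SHA-PINF-CERTIFIED-g6.tsv`, `JOIN-KURIHARA-LOCAL-g6.*`,
`j5impl2-j103457/`, `JOIN-KURIHARA-PADIC-g6.*`). -/

/-- DATA (not a theorem): J4-g6 lane records `(E, p, n)` joined and consistent, by prime and by rank; class-mate rows; census
classes (`N ≤ 59 998`) with at least one certificate; census curves with `Ш(E)[p^∞] = 0` proved at `k` of the primes 5, 7, 11, 13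
(digest `SHA-PINF-CERTIFIED-g6.tsv`); mismatches. -/
structure KuriharaRefresh where
  (laneRows laneRowsRankTwo laneRowsRankThree consistent pFive pSeven : Nat)
  (pEleven pThirteen goodOrdinary goodSupersingular anomalous serreWitnessAndGalrep : Nat)
  (classMateRows classMateConsistent classesWithCertRankTwo classesRankTwoInRange classesWithCertRankThree curvesCertifiedRankTwo : Nat)
  (curvesCertifiedRankThree kOne kTwo kThree kFour mismatches : Nat)
  outputSha256 : String
  digestSha256 : String
  deriving Repr, DecidableEq

/-- DATA (not a theorem): `JOIN-KURIHARA-g6.summary.json: counts / classmate_counts / coverage`. -/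
def kuriharaRefresh : KuriharaRefresh :=
  { laneRows := 58573, laneRowsRankTwo := 58470, laneRowsRankThree := 103, consistent := 58573, pFive := 12204, pSeven := 14717, pEleven := 16153,
    pThirteen := 15499,
    goodOrdinary := 50925, goodSupersingular := 7648, anomalous := 4567, serreWitnessAndGalrep := 58573, classMateRows := 11739,
      classMateConsistent := 11739,
    classesWithCertRankTwo := 20454, classesRankTwoInRange := 24012, classesWithCertRankThree := 90, curvesCertifiedRankTwo := 25005,
      curvesCertifiedRankThree := 91,
    kOne := 1908, kTwo := 6826, kThree := 10696, kFour := 5666, mismatches := 0,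
    outputSha256 := "ce982c171b777a34", digestSha256 := "e05495dae0f2be57" }

example : kuriharaRefresh.consistent = kuriharaRefresh.laneRows ∧ kuriharaRefresh.mismatches = 0
    ∧ kuriharaRefresh.laneRowsRankTwo + kuriharaRefresh.laneRowsRankThree = kuriharaRefresh.laneRows
    ∧ kuriharaRefresh.pFive + kuriharaRefresh.pSeven + kuriharaRefresh.pEleven + kuriharaRefresh.pThirteen = kuriharaRefresh.laneRows
    ∧ kuriharaRefresh.goodOrdinary + kuriharaRefresh.goodSupersingular = kuriharaRefresh.laneRows
    ∧ kuriharaRefresh.serreWitnessAndGalrep = kuriharaRefresh.laneRows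
    ∧ kuriharaRefresh.classMateConsistent = kuriharaRefresh.classMateRows
    ∧ kuriharaRefresh.kOne + kuriharaRefresh.kTwo + kuriharaRefresh.kThree + kuriharaRefresh.kFour
      = kuriharaRefresh.curvesCertifiedRankTwo + kuriharaRefresh.curvesCertifiedRankThree := by decide

/-- DATA (not a theorem): row-level regression of the refresh against the gen-4 tables of record (`REFRESH-REGRESSION-g6.json`): per
table, gen-4 keys, gen-4 keys reappearing in `-g6` with the identical verdict columns, gen-6 keys; J5 gen-4 informational zero-level
rows retired because the lane certified the pair since; digest prime sets equal / strictly grown / shrunk. -/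
structure RefreshRegression where
  (jFourOld jFourIdentical jFourNew jFiveOld jFiveIdentical jFiveRetiredZeroLevels : Nat)
  (jSixOld jSixIdentical digestOld digestIdentical digestPrimeSetsEqual digestPrimeSetsGrown : Nat)
  (digestPrimeSetsShrunk : Nat)
  deriving Repr, DecidableEq

/-- DATA (not a theorem): `REFRESH-REGRESSION-g6.json: tables / digest_prime_sets`. -/
def refreshRegression : RefreshRegression :=
  { jFourOld := 63263, jFourIdentical := 63263, jFourNew := 70312, jFiveOld := 56655, jFiveIdentical := 56588, jFiveRetiredZeroLevels := 67,
    jSixOld := 28742, jSixIdentical := 28742,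
    digestOld := 23224, digestIdentical := 23224, digestPrimeSetsEqual := 20752, digestPrimeSetsGrown := 2472, digestPrimeSetsShrunk := 0 }

example : refreshRegression.jFourIdentical = refreshRegression.jFourOld ∧ refreshRegression.jSixIdentical = refreshRegression.jSixOld
    ∧ refreshRegression.jFiveIdentical + refreshRegression.jFiveRetiredZeroLevels = refreshRegression.jFiveOld
    ∧ refreshRegression.digestIdentical = refreshRegression.digestOld ∧ refreshRegression.digestPrimeSetsShrunk = 0
    ∧ refreshRegression.digestPrimeSetsEqual + refreshRegression.digestPrimeSetsGrown = refreshRegression.digestOld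
    ∧ refreshRegression.jFourNew = kuriharaRefresh.laneRows + kuriharaRefresh.classMateRows
    ∧ refreshRegression.digestOld + 1872 = kuriharaRefresh.curvesCertifiedRankTwo + kuriharaRefresh.curvesCertifiedRankThree := by decide

/-- DATA (not a theorem): J5-g6 — local conditions at the Kolyvagin primes on the refreshed lane: levels examined (lane hits +
zero levels), Kolyvagin prime slots of certified levels with `E(F_ℓ)[p^∞]` cyclic (total and by p), certified levels with the
Kim-Thm-1.11 hypotheses true and the reduction map an isomorphism (`M` nonsingular), anomalous levels (`a_p ≡ 1`: reported, no
theorem invoked, isomorphism observed), certified levels with all hypotheses true and `M` SINGULAR (would be an anomaly), zero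
levels with a non-cyclic prime / all cyclic and `M` singular / all cyclic and `M` nonsingular, zero pairs all locally obstructed;
implementation 2 (PARI job j103457): levels compared, `#E(F_ℓ)` agree, structures agree, singular-vs-nonsingular agree, rank agree,
error rows. -/
structure KuriharaLocalRefresh where
  (levels laneHits zeroLevels cyclicSlots cyclicSlotsPFive cyclicSlotsPSeven : Nat)
  (cyclicSlotsPEleven cyclicSlotsPThirteen isomorphismVerified anomalousObserved certifiedSingular zeroNonCyclic : Nat)
  (zeroCyclicSingular zeroCyclicNonsingular zeroPairsObstructed zeroPairs implTwoLevels implTwoCardAgree : Nat)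
  (implTwoStructureAgree implTwoSingularityAgree implTwoRankAgree implTwoErrorRows anomaliesUnderVerification : Nat)
  outputSha256 : String
  deriving Repr, DecidableEq

/-- DATA (not a theorem): `JOIN-KURIHARA-LOCAL-g6.summary.json: counts` and `j5impl2-j103457/J5-IMPL2-AGREEMENT.json: counts`. -/
def kuriharaLocalRefresh : KuriharaLocalRefresh :=
  { levels := 62435, laneHits := 58573, zeroLevels := 3862, cyclicSlots := 117249, cyclicSlotsPFive := 24472, cyclicSlotsPSeven := 29453,
    cyclicSlotsPEleven := 32324, cyclicSlotsPThirteen := 31000,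
    isomorphismVerified := 54006, anomalousObserved := 4567, certifiedSingular := 0, zeroNonCyclic := 1902, zeroCyclicSingular := 1960,
      zeroCyclicNonsingular := 0,
    zeroPairsObstructed := 1394, zeroPairs := 1394, implTwoLevels := 62435, implTwoCardAgree := 62435, implTwoStructureAgree := 62435,
      implTwoSingularityAgree := 60533,
    implTwoRankAgree := 60533, implTwoErrorRows := 0, anomaliesUnderVerification := 0, outputSha256 := "df78c7ba7047d373" }

example : kuriharaLocalRefresh.laneHits = kuriharaRefresh.laneRows
    ∧ kuriharaLocalRefresh.laneHits + kuriharaLocalRefresh.zeroLevels = kuriharaLocalRefresh.levels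
    ∧ kuriharaLocalRefresh.cyclicSlotsPFive + kuriharaLocalRefresh.cyclicSlotsPSeven + kuriharaLocalRefresh.cyclicSlotsPEleven
      + kuriharaLocalRefresh.cyclicSlotsPThirteen = kuriharaLocalRefresh.cyclicSlots
    ∧ kuriharaLocalRefresh.isomorphismVerified + kuriharaLocalRefresh.anomalousObserved = kuriharaLocalRefresh.laneHits
    ∧ kuriharaLocalRefresh.certifiedSingular = 0 ∧ kuriharaLocalRefresh.zeroCyclicNonsingular = 0
    ∧ kuriharaLocalRefresh.zeroNonCyclic + kuriharaLocalRefresh.zeroCyclicSingular = kuriharaLocalRefresh.zeroLevels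
    ∧ kuriharaLocalRefresh.zeroPairsObstructed = kuriharaLocalRefresh.zeroPairs
    ∧ kuriharaLocalRefresh.implTwoLevels = kuriharaLocalRefresh.levels
    ∧ kuriharaLocalRefresh.implTwoCardAgree = kuriharaLocalRefresh.levels
    ∧ kuriharaLocalRefresh.implTwoStructureAgree = kuriharaLocalRefresh.levels
    ∧ kuriharaLocalRefresh.implTwoSingularityAgree = kuriharaLocalRefresh.laneHits + kuriharaLocalRefresh.zeroCyclicSingular
    ∧ kuriharaLocalRefresh.implTwoRankAgree = kuriharaLocalRefresh.implTwoSingularityAgree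
    ∧ kuriharaLocalRefresh.implTwoErrorRows = 0 ∧ kuriharaLocalRefresh.anomaliesUnderVerification = 0 := by decide

/-- DATA (not a theorem): J6-g6 — cells `(E, p)` carrying all three of census `S`, a p-adic instrument reading (J2.3,
`JOIN-PADIC-g5`) and a Kurihara certificate (J4-g6): cells by tier and by prime, curves, p-adic two-engine cells, cells consistent
on all three. -/
structure TripleCellsRefresh where
  (cells cellsRTwoA cellsRTwoC cellsRThreeA pFive pSeven : Nat)
  (pEleven pThirteen curves padicTwoEngineCells tripleConsistent : Nat)
  outputSha256 : String
  deriving Repr, DecidableEq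

/-- DATA (not a theorem): `JOIN-KURIHARA-PADIC-g6.summary.json: counts`. -/
def tripleCellsRefresh : TripleCellsRefresh :=
  { cells := 31272, cellsRTwoA := 5799, cellsRTwoC := 25370, cellsRThreeA := 103, pFive := 6167, pSeven := 8127, pEleven := 8340, pThirteen := 8638,
    curves := 12730, padicTwoEngineCells := 2885, tripleConsistent := 31272, outputSha256 := "84c00958180bdc63" }

example : tripleCellsRefresh.cellsRTwoA + tripleCellsRefresh.cellsRTwoC + tripleCellsRefresh.cellsRThreeA = tripleCellsRefresh.cells
    ∧ tripleCellsRefresh.pFive + tripleCellsRefresh.pSeven + tripleCellsRefresh.pEleven + tripleCellsRefresh.pThirteen = tripleCellsRefresh.cells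
    ∧ tripleCellsRefresh.tripleConsistent = tripleCellsRefresh.cells := by decide

/-! ## J3.9 (final) — the 37 surjective-mod-3-image `Ш[3]`-n/a rows re-run at 10 800 s/curve (jobs j093833+j101463+j101464)

Combined table `joins-outputs/desc3-budget37-combined/desc3.jsonl` (sha256 `0da1336c5ac96b20…`): Schaefer–Stoll 3-descent, sibling engine
`desc3lib.gp` verbatim, GRH class groups (`JOB_EXACT = 0`: an `ok` row is token `GRH_BNF`, never unconditional). -/

/-- DATA (not a theorem): rows of the combined budget re-run: total (rank 2 / rank 3), `ok` with `dim Sel₃ = r` and lower bound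
`dim Ш[3] ≥ 0` attained (`okShaZero`, by rank), `ok` with a positive lower bound, rows not finished within the budget, rows credited
via a prime-to-3 isogenous class-mate that finished, and the resulting `Ш[3]`-column split of the census (unconditional /
`GRH_BNF` / n-a) as printed by the gen-6 ledger. -/
structure BudgetFinal where
  (rows rankTwo rankThree ok okShaZero okShaZeroRankTwo : Nat)
  (okShaZeroRankThree okLowerBoundPositive notFinished creditedViaIsogenyMate : Nat)
  sha256 : String
  deriving Repr, DecidableEq

/-- DATA (not a theorem): `desc3-budget37-combined/RUN.json` + `desc3.jsonl` (jobs j093833+j101463+j101464). -/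
def budgetFinal : BudgetFinal :=
  { rows := 37, rankTwo := 34, rankThree := 3, ok := 19, okShaZero := 19, okShaZeroRankTwo := 17, okShaZeroRankThree := 2,
    okLowerBoundPositive := 0, notFinished := 18, creditedViaIsogenyMate := 0, sha256 := "0da1336c5ac96b20" }

example : budgetFinal.rankTwo + budgetFinal.rankThree = budgetFinal.rows ∧ budgetFinal.ok + budgetFinal.notFinished = budgetFinal.rows
    ∧ budgetFinal.okShaZeroRankTwo + budgetFinal.okShaZeroRankThree = budgetFinal.okShaZero
    ∧ budgetFinal.okShaZero + budgetFinal.okLowerBoundPositive = budgetFinal.ok ∧ budgetFinal.okLowerBoundPositive = 0 := by decide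

/-! ## J7-g6 — the gen-6 Ш-parts ledger (`SHA-PARTS-LEDGER-g6`: p ≥ 5 digest `SHA-PINF-CERTIFIED-g6.tsv`, budget table final,
extra instrument column `p3_instrument_U3` from J8; the gen-5 ledger of record `SHA-PARTS-LEDGER.*` is kept unchanged) -/

/-- DATA (not a theorem): gen-6 ledger, per prime: census rows for which `#Ш(E)[p^∞]` is an unconditional theorem, and rows
for which it holds modulo GRH only (p = 3). -/
structure LedgerByPrime where
  p : Nat
  unconditional : Nat
  grhOnly : Nat
  deriving Repr, DecidableEq

/-- DATA (not a theorem): `SHA-PARTS-LEDGER-g6.summary.json: primes_unconditional_by_prime / primes_GRH_by_prime`. -/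
def ledgerByPrimeG6 : List LedgerByPrime := [
  { p := 2, unconditional := 358159, grhOnly := 0 },
  { p := 3, unconditional := 18331, grhOnly := 339810 },
  { p := 5, unconditional := 14546, grhOnly := 0 },
  { p := 7, unconditional := 17686, grhOnly := 0 },
  { p := 11, unconditional := 19478, grhOnly := 0 },
  { p := 13, unconditional := 18602, grhOnly := 0 } ]

/-- DATA (not a theorem): gen-6 ledger histogram of the number `k` of primes per row at which `#Ш(E)[p^∞]` is an unconditional
theorem (`k = 1` = only p = 2) and the same counting the GRH-conditional p = 3. -/
structure LedgerKHist where
  k : Nat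
  rowsUnconditional : Nat
  rowsWithGrh : Nat
  deriving Repr, DecidableEq

/-- DATA (not a theorem): `SHA-PARTS-LEDGER-g6.summary.json: k_unconditional_hist / k_all_hist`. -/
def ledgerKHistG6 : List LedgerKHist := [
  { k := 1, rowsUnconditional := 316250, rowsWithGrh := 18 },
  { k := 2, rowsUnconditional := 18592, rowsWithGrh := 333045 },
  { k := 3, rowsUnconditional := 6482, rowsWithGrh := 1908 },
  { k := 4, rowsUnconditional := 10523, rowsWithGrh := 6826 },
  { k := 5, rowsUnconditional := 6042, rowsWithGrh := 10696 },
  { k := 6, rowsUnconditional := 270, rowsWithGrh := 5666 } ]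

/-- DATA (not a theorem): gen-6 ledger totals: rows, rows with all of 5, 7, 11, 13, rows with at least one prime ≥ 5, `Ш[3]`-column
tokens over the census (unconditional / `GRH_BNF` / n-a), the J8 instrument column (`S_A ≡ S` cells / undetermined deep cells /
supersingular MT rows), labels with a J2 instrument cell, `S = 4` rows (all two-engine `#Ш[2^∞] = 4`), flags, output sha. -/
structure LedgerTotalsG6 where
  (rows rowsAllOfFiveSevenElevenThirteen rowsSomePrimeGeFive shaThreeUnconditional shaThreeGrhBnf shaThreeNa : Nat)
  (uThreeSAEqS uThreeUndetermined uThreeSupersingularMt padicInstrumentLabels padicNonConsistent sFourRows : Nat)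
  (sFourRowsTwoEngineOrderFour flags : Nat)
  outputSha256 : String
  deriving Repr, DecidableEq

/-- DATA (not a theorem): `SHA-PARTS-LEDGER-g6.summary.json` totals (`census`, `prime_set_hist`, `p3.tokens`, `u3_instrument`, `padic_instrument`,
`S4_rows`, `n_flags`, `outputs`). -/
def ledgerTotalsG6 : LedgerTotalsG6 :=
  { rows := 358159, rowsAllOfFiveSevenElevenThirteen := 5666, rowsSomePrimeGeFive := 25096, shaThreeUnconditional := 18331, shaThreeGrhBnf := 339810,
    shaThreeNa := 18,
    uThreeSAEqS := 13496, uThreeUndetermined := 1, uThreeSupersingularMt := 6682, padicInstrumentLabels := 16774, padicNonConsistent := 0,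
    sFourRows := 42, sFourRowsTwoEngineOrderFour := 42, flags := 0, outputSha256 := "2379ec72fb2bab67" }

example : (ledgerKHistG6.map (·.rowsUnconditional)).sum = ledgerTotalsG6.rows
    ∧ (ledgerKHistG6.map (·.rowsWithGrh)).sum = ledgerTotalsG6.rows ∧ ledgerTotalsG6.rows = 358159
    ∧ ledgerTotalsG6.shaThreeUnconditional + ledgerTotalsG6.shaThreeGrhBnf + ledgerTotalsG6.shaThreeNa = ledgerTotalsG6.rows
    ∧ (ledgerByPrimeG6.filter (·.p = 3)).map (·.unconditional) = [ledgerTotalsG6.shaThreeUnconditional]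
    ∧ (ledgerByPrimeG6.filter (·.p = 3)).map (·.grhOnly) = [ledgerTotalsG6.shaThreeGrhBnf]
    ∧ (ledgerByPrimeG6.filter (·.p = 2)).map (·.unconditional) = [ledgerTotalsG6.rows]
    ∧ ledgerTotalsG6.flags = 0 ∧ ledgerTotalsG6.padicNonConsistent = 0
    ∧ ledgerTotalsG6.sFourRowsTwoEngineOrderFour = ledgerTotalsG6.sFourRows := by decide
/-- Bookkeeping across the blocks of this file: the J8 instrument column of the ledger is the J8 join (consistent / undetermined /
supersingular rows); the p ≥ 5 curves of the ledger are the J4-g6 digest; the budget credit enters the p = 3 `GRH_BNF` count. -/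
example : ledgerTotalsG6.uThreeSAEqS = u3Totals.consistent ∧ ledgerTotalsG6.uThreeUndetermined = u3Totals.undetermined
    ∧ ledgerTotalsG6.uThreeSupersingularMt = u3Totals.ssMtConsistent
    ∧ ledgerTotalsG6.rowsSomePrimeGeFive = kuriharaRefresh.curvesCertifiedRankTwo + kuriharaRefresh.curvesCertifiedRankThree
    ∧ ledgerTotalsG6.rowsAllOfFiveSevenElevenThirteen = kuriharaRefresh.kFour := by decide

end Summit.BirchSwinnertonDyer.BirchSwinnertonDyer.Rank2Observatory.AnomJoins4
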